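import Summits.BirchSwinnertonDyer.BirchSwinnertonDyer.Theorems.GoldfeldAllTwistsTwoConverseTwinBirchHalvabilityEight
import Literature.NumberTheory.EllipticCurves.TwoIsogenyDualPoints
import HarnessLib

set_option linter.dupNamespace false -- namespace `…BirchSwinnertonDyer.BirchSwinnertonDyer…` is the cell's (D-0017 nested layout)
set_option autoImplicit false

/-!
# Twin″ (item 19140), LINE B⁗ T3-I part a (core): the ISOGENOUS-SIDE obstruction to halving over a quadratic field, and
# `#X₀(49)(K)_tors = 2` for `d_K = −8qp`

Cell `bsd-goldfeld`, seat `bsd-goldfeld-s1p-c3x` (gen 11); planner ORDER (cccxvii) «LINE B⁗ — TRANCHE 3», object T3-I, file a-core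
(the generic half of T3-I-a; consumed by `…TwinAdditiveTwoPrimesTwistHalvability`). `--supports stmt-BirchSwinnertonDyer-19140` as a HELPER
(twin″ `BSDTwoCMSevenAdditiveRankOne`). FACT-FREE: no print binder, no definition, no `sorry`. HONEST FRAMING: Mordell–Weil algebra of
curves `y² = x³ + ax² + bx` over number fields; nothing about `L`-values; BSD is not proved by any of this and the item stays open.

WHY. In the Gross–Zagier quotient `𝔮₄₉ = 8I²t_W²/(n_∞k²t_K²c²w_K²·tq·|u|·c_W)` (`shaAn_eq_x049HeegnerTwistQuotient_of_heegner`) the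
factor `k ∈ {1, 2}` is `2` iff every `y ∈ W(ℚ)` is divisible by `2` in `W(K)` up to torsion. On F1/F2 (`…TwinBirchHalvability{,Eight}`)
`k = 1` was decided by a rational point with `α = [2]`; on the B⁗ family `49a1^{(−2qp)}` the image `α(E(ℚ))` has only two elements
(`#S ≤ 2`, T3-D part 2) and the obstruction lives on the ISOGENOUS curve `E′`: if `ψ(h′)` (`ψ : E′ → E` the dual isogeny,
`h′ ∈ E′(ℚ)`) is `2Q + torsion` in `E(K)`, then `α′_K(h′) ∈ {1, [a² − 4b]}`, so `α′(h′)` is one of the four rational classes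
`1, [a² − 4b], [d_K], [(a² − 4b)d_K]`; excluding the last two (a Selmer statement, file T3-I-a) bounds `#α′(E′(ℚ)) ≤ 2`, which
contradicts `#α·#α′ = 2^{rank+2}` in rank one.

WHAT IS PROVED.
* §1 `not_isSquare_seven_negEightTwoPrimesField`: `−7, 7 ∉ K²` for `K` imaginary quadratic with `d_K = −8qp` (`q, p` primes `≠ 7`);
  `torsionOrder_cm7_baseChange_eq_two_of_not_isSquare` (generic: `−7, 7 ∉ K²` ⇒ `#X₀(49)(K)_tors = 2`, F1's argument) and
  `torsionOrder_cm7_baseChange_eq_two_negEightTwoPrimes` — the factor `t_K` of `𝔮₄₉` on the B⁗ family (kit j304181: `torsK = 2`, 162/162).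
* §2 (ANY `E : y² = x³ + ax² + bx` over `ℚ`, any number field `K` with `a² − 4b, b ∉ K²`) `xSqClass_twoIsogenyPointsHom` (`α′_K ∘ φ_K = 1`),
  **`xSqClass_incl_of_twoIsogenyDual_halvable`** (`ψ(h′) ∈ 2E(K) + tors ⇒ α′_K(h′) ∈ {1, [a² − 4b]}`: `ψ_K ∘ φ_K = [2]`,
  `ker ψ_K = {O, T′}`, `T ∉ ψ_K(E′(K))`; Literature `TwoIsogenyDualPoints`, `TwoIsogenyDescentIndex`, `TwoIsogenyDescentOddMultipleProofs`),
  `xSqClass_cases_of_xSqClass_incl` (reading a rational class in an imaginary quadratic `K`: `isSquare_or_of_isSquare_algebraMap_rat`).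
* §3 `xSqClass_codomain_mem_pair_of_forall_halvable`, **`not_forall_halvable_of_descent`**: with the classes `[d_K]`, `[a′₄d_K]` excluded
  from `α′(E′(ℚ))`, `#α(E(ℚ)) ≤ 2` and `rank E(ℚ) = 1`, NOT every `y ∈ E(ℚ)` is halvable in `E(K)` up to torsion
  (`natCard_range_xSqClass_mul`).
References: [SilvermanTate2015] §3.4 Prop. 3.7, §3.5 Prop. 3.8, §3.6; [SilvermanAEC2009] III.4.5, X.4.9, Exercise 10.16.
-/

noncomputable section

open scoped Classical

open WeierstrassCurve Literature.NumberTheory.EllipticCurves Literature.NumberTheory.EllipticCurves.ModularForms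
  WeierstrassCurve.QuadraticDescent
open WeierstrassCurve.Affine (sqClass sqClass_mul sqClass_eq_one_iff)

namespace Summit.BirchSwinnertonDyer.BirchSwinnertonDyer.Theorems.GoldfeldGoodTwists

/-! ## §1 `−7, 7 ∉ K²` for `d_K = −8qp`, and `#X₀(49)(K)_tors = 2` -/

section SquaresTorsion

variable {K : Type} [Field K] [NumberField K]

/-- `14·m` is not a square for `7 ∤ m` (`7` divides it exactly once). [folklore] -/
private theorem not_isSquare_fourteen_mul_of_not_seven_dvd {m : ℕ} (hm : ¬ 7 ∣ m) : ¬ IsSquare (14 * m) := by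
  rintro ⟨s, hs⟩
  have h7s : 7 ∣ s := by
    have : 7 ∣ s * s := ⟨2 * m, by rw [← hs]; ring⟩
    exact ((Nat.Prime.dvd_mul (by norm_num)).mp this).elim id id
  obtain ⟨t, rfl⟩ := h7s
  have h : 2 * m = 7 * (t * t) := by
    have : 7 * (2 * m) = 7 * (7 * (t * t)) := by linear_combination hs
    exact Nat.eq_of_mul_eq_mul_left (by norm_num) this
  have h7 : 7 ∣ 2 * m := ⟨t * t, h⟩
  rcases (Nat.Prime.dvd_mul (by norm_num)).mp h7 with h' | h'
  · omega
  · exact hm h'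

/-- **`−7, 7` are not squares in `K`** for `K` imaginary quadratic with `d_K = −8qp`, `q, p` primes `≠ 7`: a rational square in `K`
is a square in `ℚ` or `d_K` times one (`isSquare_or_of_isSquare_algebraMap_rat`); `−7·(−8qp) = 14qp·2²` carries `7` once and
`7·(−8qp) < 0`. [cite: SilvermanTate2015, §3.5] -/
theorem not_isSquare_seven_negEightTwoPrimesField (hK : IsImaginaryQuadratic K) {q p : ℕ} (hq : q.Prime) (hp : p.Prime)
    (hq7 : q ≠ 7) (hp7 : p ≠ 7) (hdK : NumberField.discr K = -(8 * (q : ℤ) * p)) :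
    ¬ IsSquare (-7 : K) ∧ ¬ IsSquare (7 : K) := by
  have hdQ : ((NumberField.discr K : ℤ) : ℚ) = -(8 * (q : ℚ) * p) := by rw [hdK]; push_cast; ring
  have red : ∀ c : ℚ, IsSquare ((c : K)) → IsSquare c ∨ IsSquare (c * -(8 * (q : ℚ) * p)) := by
    intro c hc
    rw [← hdQ]
    refine isSquare_or_of_isSquare_algebraMap_rat hK ?_
    rwa [eq_ratCast]
  have h7qp : ¬ 7 ∣ q * p := fun h ↦ ((Nat.Prime.dvd_mul (by norm_num)).mp h).elim
    (fun h' ↦ hq7 ((Nat.prime_dvd_prime_iff_eq (by norm_num) hq).mp h').symm)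
    (fun h' ↦ hp7 ((Nat.prime_dvd_prime_iff_eq (by norm_num) hp).mp h').symm)
  have hq0 : (0 : ℚ) < q := by exact_mod_cast hq.pos
  have hp0 : (0 : ℚ) < p := by exact_mod_cast hp.pos
  constructor
  · intro h
    rcases red (-7) (by push_cast; exact h) with h' | h'
    · exact not_isSquare_of_neg (by norm_num) h'
    · have h14 : IsSquare (((14 * (q * p) : ℕ) : ℚ)) := by
        push_cast
        exact isSquare_of_isSquare_four_mul (by convert h' using 1; ring)
      exact not_isSquare_fourteen_mul_of_not_seven_dvd h7qp (Rat.isSquare_natCast_iff.mp h14)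
  · intro h
    rcases red 7 (by push_cast; exact h) with h' | h'
    · exact not_isSquare_prime (p := 7) (by norm_num) (Rat.isSquare_natCast_iff.mp (by exact_mod_cast h'))
    · exact not_isSquare_of_neg (by nlinarith [mul_pos hq0 hp0]) h'

/-- **`M₀(K)_tors = {O, T}`** (`M₀ = ⟨0, 21, 0, 112, 0⟩`) for `K` imaginary quadratic with `−7, 7 ∉ K²`: a torsion point has an odd
multiple in `{O, T}` (`−7 = a² − 4b`, `7 ~ b = 112`; Literature `exists_odd_nsmul_mem_pair`), so `2 • t` is killed by an odd integer,
hence `O` (F1's `eq_zero_of_odd_nsmul_eq_zero_M0`, generic in `K`). [cite: SilvermanTate2015, §3.5] [cite: SilvermanAEC2009, Exercise 10.16] -/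
theorem isOfFinAddOrder_iff_M0_K_of_not_isSquare (hK : IsImaginaryQuadratic K) (h7 : ¬ IsSquare (-7 : K))
    (h7' : ¬ IsSquare (7 : K)) (t : (⟨0, 21, 0, 112, 0⟩ : WeierstrassCurve K).toAffine.Point) :
    IsOfFinAddOrder t ↔ t = 0 ∨ t = (haveI := isElliptic_M0_K (K := K);
      (⟨0, 21, 0, 112, 0⟩ : WeierstrassCurve K).twoTorsionPoint) := by
  haveI := isElliptic_M0_K (K := K)
  have hD : ¬ IsSquare ((⟨0, 21, 0, 112, 0⟩ : WeierstrassCurve K).a₂ ^ 2 -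
      4 * (⟨0, 21, 0, 112, 0⟩ : WeierstrassCurve K).a₄) := by
    rw [show ((⟨0, 21, 0, 112, 0⟩ : WeierstrassCurve K).a₂ ^ 2 -
      4 * (⟨0, 21, 0, 112, 0⟩ : WeierstrassCurve K).a₄) = -7 by norm_num]
    exact h7
  have hb : ¬ IsSquare (⟨0, 21, 0, 112, 0⟩ : WeierstrassCurve K).a₄ := by
    rw [show (⟨0, 21, 0, 112, 0⟩ : WeierstrassCurve K).a₄ = 112 by rfl]
    rintro ⟨r, hr⟩
    exact h7' (isSquare_of_sq_mul (k := 4) (by norm_num) (by linear_combination hr.symm))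
  constructor
  · intro ht
    obtain ⟨m, hm, h⟩ := (⟨0, 21, 0, 112, 0⟩ : WeierstrassCurve K).exists_odd_nsmul_mem_pair hD hb ht
    have h2m : m • ((2 : ℕ) • t) = 0 := by
      rw [← mul_nsmul', mul_comm, mul_nsmul']
      rcases h with h | h
      · rw [h, nsmul_zero]
      · rw [h, two_nsmul, twoTorsionPoint_add_twoTorsionPoint]
    have h2 : (2 : ℕ) • t = 0 := eq_zero_of_odd_nsmul_eq_zero_M0 hK _ hm h2m
    exact (⟨0, 21, 0, 112, 0⟩ : WeierstrassCurve K).eq_zero_or_eq_twoTorsionPoint_of_two_nsmul_eq_zero hD t h2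
  · rintro (rfl | rfl)
    · exact IsOfFinAddOrder.zero
    · exact isOfFinAddOrder_iff_nsmul_eq_zero.mpr ⟨2, two_pos, by rw [two_nsmul, twoTorsionPoint_add_twoTorsionPoint]⟩

/-- **`#X₀(49)(K)_tors = 2` whenever `−7, 7 ∉ K²`** (`K` imaginary quadratic): `#M₀(K)_tors = 2` transported along
`cm7NFChange K • (X₀(49) ⊗ K) = M₀` (`torsionOrder_variableChange_holds`). [cite: SilvermanTate2015, §3.5] [cite: SilvermanAEC2009, Exercise 10.16] -/
theorem torsionOrder_cm7_baseChange_eq_two_of_not_isSquare (hK : IsImaginaryQuadratic K) (h7 : ¬ IsSquare (-7 : K))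
    (h7' : ¬ IsSquare (7 : K)) : (cm7.baseChange K).torsionOrder = 2 := by
  have h := torsionOrder_variableChange_holds (cm7.baseChange K) (cm7NFChange K)
  unfold torsionOrder_variableChange at h
  rw [cm7NFChange_smul] at h
  rw [← h]
  haveI := isElliptic_M0_K (K := K)
  unfold WeierstrassCurve.torsionOrder
  set T := (⟨0, 21, 0, 112, 0⟩ : WeierstrassCurve K).twoTorsionPoint with hT
  have hTtors : T ∈ AddCommGroup.torsion (⟨0, 21, 0, 112, 0⟩ : WeierstrassCurve K).toAffine.Point :=
    (AddCommGroup.mem_torsion _).mpr ((isOfFinAddOrder_iff_M0_K_of_not_isSquare hK h7 h7' T).mpr (Or.inr rfl))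
  have hT0 : T ≠ 0 := twoTorsionPoint_ne_zero _
  rw [Nat.card_eq_two_iff' (⟨T, hTtors⟩ : AddCommGroup.torsion (⟨0, 21, 0, 112, 0⟩ : WeierstrassCurve K).toAffine.Point)]
  refine ⟨0, fun h0 => hT0 (congrArg Subtype.val h0).symm, fun y hy => ?_⟩
  have hyfin : IsOfFinAddOrder (y : (⟨0, 21, 0, 112, 0⟩ : WeierstrassCurve K).toAffine.Point) := y.2
  rcases (isOfFinAddOrder_iff_M0_K_of_not_isSquare hK h7 h7' _).mp hyfin with h | h
  · exact Subtype.ext h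
  · exact absurd (Subtype.ext h) hy

/-- **`#X₀(49)(K)_tors = 2` for every imaginary quadratic `K` with `d_K = −8qp`**, `q, p` primes `≠ 7` — the factor `t_K` of `𝔮₄₉`
on the B⁗ family (kit j304181: `torsK = 2` on 162/162). [cite: SilvermanTate2015, §3.5] [cite: SilvermanAEC2009, Exercise 10.16] -/
theorem torsionOrder_cm7_baseChange_eq_two_negEightTwoPrimes (hK : IsImaginaryQuadratic K) {q p : ℕ} (hq : q.Prime)
    (hp : p.Prime) (hq7 : q ≠ 7) (hp7 : p ≠ 7) (hdK : NumberField.discr K = -(8 * (q : ℤ) * p)) :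
    (cm7.baseChange K).torsionOrder = 2 := by
  obtain ⟨h7, h7'⟩ := not_isSquare_seven_negEightTwoPrimesField hK hq hp hq7 hp7 hdK
  exact torsionOrder_cm7_baseChange_eq_two_of_not_isSquare hK h7 h7'

end SquaresTorsion

/-! ## §2 The isogenous-side obstruction to halving `ψ(h′)` over `K` (any `E : y² = x³ + ax² + bx` over `ℚ`) -/

section IsogenyDescentOverK

variable {K : Type} [Field K] [NumberField K]

/-- Two non-zero field elements with square product have the same square class. [folklore] -/
private theorem sqClass_eq_sqClass_of_isSquare_mul_b4 {F : Type*} [Field F] {x y : F} (hx : x ≠ 0) (hy : y ≠ 0)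
    (h : IsSquare (x * y)) : sqClass x = sqClass y := by
  obtain ⟨r, hr⟩ := h
  have h1 : sqClass x * sqClass y = 1 := by
    rw [← sqClass_mul hx hy]; exact (sqClass_eq_one_iff (mul_ne_zero hx hy)).mpr ⟨r, by rw [hr, pow_two]⟩
  rw [Affine.SqUnits.eq_mul_of_mul_eq h1, Affine.SqUnits.one_mul]

/-- `α` is transported along an equality of curves (`Affine.Point.congrEquiv`). [folklore] -/
theorem xSqClass_congrEquiv {F : Type*} [Field F] {W₁ W₂ : WeierstrassCurve F} (h : W₁ = W₂) (P : W₁.toAffine.Point) :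
    W₂.xSqClass (Affine.Point.congrEquiv h P) = W₁.xSqClass P := by
  subst h; rfl

/-- `α′_K ∘ φ_K = 1`: the `K`-points in the image of the explicit `2`-isogeny `φ_K : E(K) → E′(K)` have trivial `α′`
(`ker ᾱ = φ(Γ)`, Silverman–Tate Prop. 3.8(b), over the extension `K`). [cite: SilvermanTate2015, §3.5 Prop. 3.8(b)] -/
theorem xSqClass_twoIsogenyPointsHom (E : WeierstrassCurve ℚ) [E.IsTwoTorsionNF] [E.IsElliptic]
    (S : (E.baseChange K).toAffine.Point) :
    (E.twoIsogenyCodomain.baseChange K).xSqClass (E.twoIsogenyPointsHom K S) = 1 := by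
  haveI : (E.baseChange K).IsElliptic := by rw [WeierstrassCurve.baseChange]; infer_instance
  have h := ((E.baseChange K).xSqClass_eq_one_iff_exists ((E.baseChange K).twoIsogenyFun S)).mpr ⟨S, rfl⟩
  rw [twoIsogenyPointsHom, AddMonoidHom.comp_apply, twoIsogenyHom_apply]
  change (E.twoIsogenyCodomain.baseChange K).xSqClass
    (Affine.Point.congrEquiv (twoIsogenyCodomain_baseChange E K) ((E.baseChange K).twoIsogenyFun S)) = 1
  rw [xSqClass_congrEquiv]
  exact h

/-- **The isogenous-side obstruction.** `E : y² = x³ + ax² + bx` over `ℚ`, `K` a number field in which neither `a² − 4b` nor `b`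
is a square, `ψ : E′ → E` the dual of the explicit `2`-isogeny `φ : E → E′`, `h′ ∈ E′(ℚ)`. If `ψ(h′) = 2Q + t` in `E(K)` with `t`
torsion, then **`α′_K(h′) ∈ {1, [a² − 4b]}`**: take `m` odd with `m•t ∈ {O, T}` (`exists_odd_nsmul_mem_pair`); `m•t = T` is impossible
(`T ∉ ψ_K(E′(K))` as `α_K(T) = [b] ≠ 1`); so `m•h′ − φ_K(m•Q) ∈ ker ψ_K = {O, T′}` (`ψ_K ∘ φ_K = [2]`), and `α′_K` of it is `1` or
`[a² − 4b]`, while `α′_K ∘ φ_K = 1` and `α′_K(m•h′) = α′_K(h′)`. [cite: SilvermanTate2015, §3.4 Prop. 3.7 and §3.5 Prop. 3.8]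
[cite: SilvermanAEC2009, III.4.5 and X.4.9] -/
theorem xSqClass_incl_of_twoIsogenyDual_halvable (E : WeierstrassCurve ℚ) [E.IsTwoTorsionNF] [E.IsElliptic]
    (hD : ¬ IsSquare ((E.baseChange K).a₂ ^ 2 - 4 * (E.baseChange K).a₄)) (hb : ¬ IsSquare (E.baseChange K).a₄)
    (h' : E.twoIsogenyCodomain.toAffine.Point) (Q : (E.baseChange K).toAffine.Point)
    (ht : IsOfFinAddOrder (incl K E (E.twoIsogenyDualFun h') - (2 : ℤ) • Q)) :
    (E.twoIsogenyCodomain.baseChange K).xSqClass (incl K E.twoIsogenyCodomain h') = 1 ∨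
      (E.twoIsogenyCodomain.baseChange K).xSqClass (incl K E.twoIsogenyCodomain h') =
        sqClass (E.twoIsogenyCodomain.baseChange K).a₄ := by
  haveI : (E.baseChange K).IsElliptic := by rw [WeierstrassCurve.baseChange]; infer_instance
  haveI : (E.twoIsogenyCodomain.baseChange K).IsElliptic := by rw [WeierstrassCurve.baseChange]; infer_instance
  -- `ι(ψ h′) = ψ_K(ι h′)` (the dual is defined over `ℚ`)
  have h1 : incl K E (E.twoIsogenyDualFun h') = E.twoIsogenyDualPointsFun K (incl K E.twoIsogenyCodomain h') := by
    have h := map_twoIsogenyDualPointsFun E (L := ℚ) (Algebra.ofId ℚ K) h'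
    rw [twoIsogenyDualPointsFun_base] at h
    exact h
  -- an odd `m` with `m • t ∈ {O, T}`
  obtain ⟨m, hm, hmt⟩ := (E.baseChange K).exists_odd_nsmul_mem_pair hD hb ht
  have hmZ : Odd (m : ℤ) := by exact_mod_cast hm
  -- `ψ_K (m • ι h′ − φ_K (m • Q)) = m • t`
  set R := (m : ℤ) • incl K E.twoIsogenyCodomain h' - E.twoIsogenyPointsHom K ((m : ℤ) • Q) with hR
  have key : E.twoIsogenyDualPointsFun K R = (m : ℤ) • (incl K E (E.twoIsogenyDualFun h') - (2 : ℤ) • Q) := by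
    rw [hR, ← twoIsogenyDualPointsHom_apply, map_sub, map_zsmul, twoIsogenyDualPointsHom_apply,
      twoIsogenyDualPointsHom_apply, ← h1, twoIsogenyDualPointsFun_twoIsogenyPointsHom, smul_sub, two_nsmul, two_zsmul,
      smul_add]
  rw [← natCast_zsmul] at hmt
  rcases hmt with h0 | hT
  · -- `R ∈ ker ψ_K = {O, T′}`
    have hR0 := (twoIsogenyDualPointsFun_eq_zero_iff E R).mp (key.trans h0)
    have e : (m : ℤ) • incl K E.twoIsogenyCodomain h' = E.twoIsogenyPointsHom K ((m : ℤ) • Q) + R := by rw [hR]; abel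
    have hα := congrArg (E.twoIsogenyCodomain.baseChange K).xSqClass e
    rw [xSqClass_zsmul_of_odd _ hmZ, xSqClass_add, xSqClass_twoIsogenyPointsHom, Affine.SqUnits.one_mul] at hα
    rcases hR0 with hR0 | hR0
    · left; rw [hα, hR0, xSqClass_zero]
    · right; rw [hα, hR0, xSqClass_twoTorsionPoint]
  · -- `T ∈ ψ_K(E′(K))` is impossible: `α_K(T) = [b] ≠ 1`
    exfalso
    have h1' := (xSqClass_eq_one_iff_exists_twoIsogenyDualPointsFun E (E.baseChange K).twoTorsionPoint).mpr ⟨R, key.trans hT⟩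
    rw [xSqClass_twoTorsionPoint, sqClass_eq_one_iff (a₄_ne_zero _)] at h1'
    obtain ⟨u, hu⟩ := h1'
    exact hb ⟨u, by rw [hu, pow_two]⟩


/-- **Reading a rational square class in a quadratic field.** `V : y² = x³ + ax² + bx` over `ℚ`, `K` imaginary quadratic, `P ∈ V(ℚ)`:
if `α_K(ι P) ∈ {1, [b]_K}` then `α(P) ∈ {1, [b], [d_K], [b·d_K]}` — a rational square in `K` is a square in `ℚ` or `d_K` times one
(`isSquare_or_of_isSquare_algebraMap_rat`). [cite: SilvermanTate2015, §3.5] -/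
theorem xSqClass_cases_of_xSqClass_incl (hK : IsImaginaryQuadratic K) (V : WeierstrassCurve ℚ) [V.IsTwoTorsionNF] [V.IsElliptic]
    (P : V.toAffine.Point)
    (hA : (V.baseChange K).xSqClass (incl K V P) = 1 ∨ (V.baseChange K).xSqClass (incl K V P) = sqClass (V.baseChange K).a₄) :
    V.xSqClass P = 1 ∨ V.xSqClass P = sqClass V.a₄ ∨ V.xSqClass P = sqClass ((NumberField.discr K : ℤ) : ℚ) ∨
      V.xSqClass P = sqClass (V.a₄ * ((NumberField.discr K : ℤ) : ℚ)) := by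
  have hb0 : V.a₄ ≠ 0 := a₄_ne_zero V
  have hd0 : ((NumberField.discr K : ℤ) : ℚ) ≠ 0 := by exact_mod_cast NumberField.discr_ne_zero K
  rcases P with _ | ⟨x, y, h⟩
  · exact Or.inl rfl
  · by_cases hx : x = 0
    · exact Or.inr (Or.inl (xSqClass_some_of_eq_zero h hx))
    · have hxK : algebraMap ℚ K x ≠ 0 := by rw [eq_ratCast]; exact_mod_cast hx
      have hmap : incl K V (.some x y h) = .some (algebraMap ℚ K x) (algebraMap ℚ K y)
          ((Affine.baseChange_nonsingular (W := V) (f := Algebra.ofId ℚ K) (algebraMap ℚ K).injective x y).mpr h) := rfl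
      have ha4K : (V.baseChange K).a₄ = algebraMap ℚ K V.a₄ := rfl
      rw [hmap, xSqClass_some_of_ne_zero _ hxK, ha4K] at hA
      rw [xSqClass_some_of_ne_zero h hx]
      rcases hA with hA | hA
      · -- `x ∈ K²`: `x ∈ ℚ²` or `x·d_K ∈ ℚ²`
        obtain ⟨u, hu⟩ := (sqClass_eq_one_iff hxK).mp hA
        rcases isSquare_or_of_isSquare_algebraMap_rat hK ⟨u, by rw [hu, pow_two]⟩ with hsq | hsq
        · obtain ⟨r, hr⟩ := hsq
          exact Or.inl ((sqClass_eq_one_iff hx).mpr ⟨r, by rw [hr, pow_two]⟩)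
        · exact Or.inr (Or.inr (Or.inl (sqClass_eq_sqClass_of_isSquare_mul_b4 hx hd0 hsq)))
      · -- `x·b ∈ K²`: `x·b ∈ ℚ²` or `x·b·d_K ∈ ℚ²`
        have h1 : sqClass (algebraMap ℚ K (x * V.a₄)) = 1 := by
          rw [map_mul, sqClass_mul hxK (by rw [eq_ratCast]; exact_mod_cast hb0), hA, Affine.SqUnits.mul_self]
        obtain ⟨u, hu⟩ := (sqClass_eq_one_iff (by rw [eq_ratCast]; exact_mod_cast mul_ne_zero hx hb0)).mp h1
        rcases isSquare_or_of_isSquare_algebraMap_rat hK ⟨u, by rw [hu, pow_two]⟩ with hsq | hsq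
        · exact Or.inr (Or.inl (sqClass_eq_sqClass_of_isSquare_mul_b4 hx hb0 hsq))
        · rw [mul_assoc] at hsq
          exact Or.inr (Or.inr (Or.inr (sqClass_eq_sqClass_of_isSquare_mul_b4 hx (mul_ne_zero hb0 hd0) hsq)))

end IsogenyDescentOverK

/-! ## §3 The count: `α′(E′(ℚ)) ⊆ {1, [a′₄]}` is incompatible with `#α(E(ℚ)) ≤ 2` in rank one (any `E`) -/

section Count

variable {K : Type} [Field K] [NumberField K]

/-- **Under «every `y ∈ E(ℚ)` is halvable in `E(K)` up to torsion», `α′(E′(ℚ)) ⊆ {1, [a′₄]}`** — for any `E : y² = x³ + ax² + bx`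
over `ℚ` and `K` imaginary quadratic with `a² − 4b, b ∉ K²`, PROVIDED no class of `α′(E′(ℚ))` is `[d_K]` or `[a′₄·d_K]` (the two
classes that die in `K^×/K^{×2}`): §2 at `h′` and the reading lemma. [cite: SilvermanTate2015, §3.5–3.6] [cite: SilvermanAEC2009, Prop. X.4.9] -/
theorem xSqClass_codomain_mem_pair_of_forall_halvable (hK : IsImaginaryQuadratic K) (E : WeierstrassCurve ℚ)
    [E.IsTwoTorsionNF] [E.IsElliptic]
    (hD : ¬ IsSquare ((E.baseChange K).a₂ ^ 2 - 4 * (E.baseChange K).a₄)) (hb : ¬ IsSquare (E.baseChange K).a₄)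
    (hne : ∀ P : E.twoIsogenyCodomain.toAffine.Point,
      E.twoIsogenyCodomain.xSqClass P ≠ sqClass ((NumberField.discr K : ℤ) : ℚ) ∧
        E.twoIsogenyCodomain.xSqClass P ≠ sqClass (E.twoIsogenyCodomain.a₄ * ((NumberField.discr K : ℤ) : ℚ)))
    (hall : ∀ y : E.toAffine.Point, ∃ Q : (E.baseChange K).toAffine.Point,
      incl K E y - (2 : ℤ) • Q ∈ AddCommGroup.torsion (E.baseChange K).toAffine.Point)
    (h' : E.twoIsogenyCodomain.toAffine.Point) :
    E.twoIsogenyCodomain.xSqClass h' = 1 ∨ E.twoIsogenyCodomain.xSqClass h' = sqClass E.twoIsogenyCodomain.a₄ := by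
  obtain ⟨Q, hQ⟩ := hall (E.twoIsogenyDualFun h')
  have hA := xSqClass_incl_of_twoIsogenyDual_halvable E hD hb h' Q ((AddCommGroup.mem_torsion _).mp hQ)
  rcases xSqClass_cases_of_xSqClass_incl hK _ h' hA with h1 | h1 | h1 | h1
  · exact Or.inl h1
  · exact Or.inr h1
  · exact absurd h1 (hne h').1
  · exact absurd h1 (hne h').2

/-- **The count.** Same setting, with `#α(E(ℚ)) ≤ 2` and `rank E(ℚ) = 1`: NOT every `y ∈ E(ℚ)` is halvable in `E(K)` up to torsion —
otherwise `#α′(E′(ℚ)) ≤ 2` too, contradicting `#α·#α′ = 2^{rank+2} = 8` (Literature `natCard_range_xSqClass_mul`).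
[cite: SilvermanTate2015, §3.6 (2^r = #α(Γ)·#ᾱ(Γ̄)/4)] [cite: SilvermanAEC2009, Prop. X.4.9] -/
theorem not_forall_halvable_of_descent (hK : IsImaginaryQuadratic K) (E : WeierstrassCurve ℚ) [E.IsTwoTorsionNF] [E.IsElliptic]
    (hD : ¬ IsSquare ((E.baseChange K).a₂ ^ 2 - 4 * (E.baseChange K).a₄)) (hb : ¬ IsSquare (E.baseChange K).a₄)
    (hne : ∀ P : E.twoIsogenyCodomain.toAffine.Point,
      E.twoIsogenyCodomain.xSqClass P ≠ sqClass ((NumberField.discr K : ℤ) : ℚ) ∧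
        E.twoIsogenyCodomain.xSqClass P ≠ sqClass (E.twoIsogenyCodomain.a₄ * ((NumberField.discr K : ℤ) : ℚ)))
    (hα : Nat.card (Set.range E.xSqClass) ≤ 2) (hr : E.mordellWeilRank = 1) :
    ¬ ∀ y : E.toAffine.Point, ∃ Q : (E.baseChange K).toAffine.Point,
        incl K E y - (2 : ℤ) • Q ∈ AddCommGroup.torsion (E.baseChange K).toAffine.Point := by
  intro hall
  have hsub : Set.range E.twoIsogenyCodomain.xSqClass ⊆ ↑({1, sqClass E.twoIsogenyCodomain.a₄} : Finset (Affine.SqUnits ℚ)) := by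
    rintro c ⟨h', rfl⟩
    rw [Finset.coe_insert, Finset.coe_singleton]
    rcases xSqClass_codomain_mem_pair_of_forall_halvable hK E hD hb hne hall h' with h | h
    · exact Or.inl h
    · exact Or.inr h
  have hα' : Nat.card (Set.range E.twoIsogenyCodomain.xSqClass) ≤ 2 :=
    calc Nat.card (Set.range E.twoIsogenyCodomain.xSqClass)
        ≤ Nat.card (↑({1, sqClass E.twoIsogenyCodomain.a₄} : Finset (Affine.SqUnits ℚ)) : Set (Affine.SqUnits ℚ)) :=
          Nat.card_mono (Finset.finite_toSet _) hsub
      _ = ({1, sqClass E.twoIsogenyCodomain.a₄} : Finset (Affine.SqUnits ℚ)).card := by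
          rw [Nat.card_coe_set_eq, Set.ncard_coe_finset]
      _ ≤ 2 := Finset.card_le_two
  have hcount := E.natCard_range_xSqClass_mul
  rw [hr, show (2 : ℕ) ^ ((1 : ℕ) + 2) = 8 by norm_num] at hcount
  have h4 : Nat.card (Set.range E.xSqClass) * Nat.card (Set.range E.twoIsogenyCodomain.xSqClass) ≤ 2 * 2 :=
    Nat.mul_le_mul hα hα'
  omega

end Count

end Summit.BirchSwinnertonDyer.BirchSwinnertonDyer.Theorems.GoldfeldGoodTwists

end
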